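import Mathlib.Combinatorics.SimpleGraph.Acyclic
import Literature.AnabelianGeometry.SemiGraphs.SubdivisionLemmas
import HarnessLib

/-!
# Escape trees `Y_K`: an explicit family of infinite trees (test objects for [SemiAnbd] Thm. 3.7 (iii) at infinite graphs)

Mochizuki, *Semi-graphs of anabelioids*, Publ. RIMS **42** (2006), §3, Theorem 3.7 (iii), manuscript
pp. 40–41 [cite: MochizukiSemiAnbd2006, Thm 3.7(iii) pp.40-41].  The printed proof derives, for a compact
subgroup `H ⊆ π₁^temp(𝒢)` acting on the trees `𝒢_{∞,j}` of a cofinal system of finite étale coverings,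
that "we may assume that there exists a compatible system of vertices of `𝒢_{∞,j}`, for `j ∈ J`, each of
which is fixed by `H`" (p. 41) — using, at exactly this point, that "the semi-graphs `𝔾_j` are all finite".
For an infinite countable `𝒢` the existence of such a COMPATIBLE fixed system is the residual of the cell's
Thm. 3.7 (iii) work (gap G-t6g3-2b, the clause `hfix` of `compactInVerticial_of_fixedSystems`; desk
countermodel candidate `𝒢_θ` on record).

This file builds the combinatorial TEST OBJECTS for that residual: the semi-graphs `Y_K = escapeTree K`
(`K : ℕ`) — the ray `(false, n), n ∈ ℕ` («line») with an arm `(true, n), n < K` attached at height `K` —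
and proves that each `Y_K` is a tree (`escapeTree_isTree`) by a rooted-parent criterion for simple graphs
(`SimpleGraph.isTree_of_parent`: a rank strictly decreasing along a parent map whose graph is the whole
adjacency relation; classical).  The folds `Y_{K'} ⟶ Y_K`, the swap involutions and the escaping tower they
form are in `TreeSystemEscapeMaps.lean` / `TreeSystemEscapeTower.lean`.

Nothing in this file takes a side on [IUTchIII] Cor. 3.12; it asserts nothing about `π₁^temp`.
-/

namespace Literature.AnabelianGeometry.SemiGraphs

open CategoryTheory

universe u

/-! ### A rooted-parent criterion for trees -/

/-- **Rooted-parent criterion.**  Let `G` be a simple graph with a distinguished vertex `root`, a map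
`par : V → V` and a rank `rk : V → ℕ` such that every non-root vertex is adjacent to its parent, of
strictly smaller rank, and every adjacency is of the form `{x, par x}` with `x ≠ root`.  Then `G` is a tree:
connected (follow parents down to the root) and acyclic (a vertex of maximal rank on a cycle would have its
two distinct cycle-neighbours both equal to its parent).  Classical.
[cite: MochizukiSemiAnbd2006, §1 p.13] -/
theorem _root_.SimpleGraph.isTree_of_parent {V : Type u} {G : SimpleGraph V} (root : V) (par : V → V)
    (rk : V → ℕ) (hlt : ∀ x, x ≠ root → rk (par x) < rk x)
    (hpar : ∀ x, x ≠ root → G.Adj x (par x))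
    (hadj : ∀ ⦃x y⦄, G.Adj x y → (x ≠ root ∧ y = par x) ∨ (y ≠ root ∧ x = par y)) : G.IsTree := by
  classical
  -- every vertex reaches the root
  have hreach : ∀ x, G.Reachable x root := by
    intro x
    induction hx : rk x using Nat.strong_induction_on generalizing x with
    | _ n ih =>
      by_cases hxr : x = root
      · subst hxr; exact SimpleGraph.Reachable.refl _
      · have h1 : G.Reachable (par x) root := ih (rk (par x)) (hx ▸ hlt x hxr) (par x) rfl
        exact (SimpleGraph.Adj.reachable (hpar x hxr)).trans h1
  haveI : Nonempty V := ⟨root⟩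
  refine ⟨⟨fun x y => (hreach x).trans (hreach y).symm⟩, ?_⟩
  -- acyclic: take a vertex of maximal rank on a cycle
  intro v c hc
  obtain ⟨u, hu, hmax⟩ := c.support.toFinset.exists_max_image rk ⟨v, by simp⟩
  rw [List.mem_toFinset] at hu
  set c' := c.rotate u hu with hc'def
  have hc' : c'.IsCycle := hc.rotate hu
  have hnil : ¬ c'.Nil := hc'.not_nil
  have hmax' : ∀ w ∈ c'.support, rk w ≤ rk u := fun w hw =>
    hmax w (by rw [List.mem_toFinset]; exact (c.mem_support_rotate_iff u hu).mp hw)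
  have h1 : G.Adj u c'.snd := c'.adj_snd hnil
  have h2 : G.Adj c'.penultimate u := c'.adj_penultimate hnil
  have hs : rk c'.snd ≤ rk u := hmax' _ (c'.getVert_mem_support 1)
  have hp : rk c'.penultimate ≤ rk u := hmax' _ (c'.getVert_mem_support _)
  -- both neighbours are the parent of `u`
  have e1 : c'.snd = par u := by
    rcases hadj h1 with ⟨-, h⟩ | ⟨hne, h⟩
    · exact h
    · have h3 := hlt _ hne
      rw [← h] at h3
      exact absurd h3 (not_lt.mpr hs)
  have e2 : c'.penultimate = par u := by
    rcases hadj h2 with ⟨hne, h⟩ | ⟨-, h⟩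
    · have h3 := hlt _ hne
      rw [← h] at h3
      exact absurd h3 (not_lt.mpr hp)
    · exact h
  exact hc'.snd_ne_penultimate (e1.trans e2.symm)


namespace SemiGraph

/-! ### The escape trees `Y_K`: a ray with an arm of length `K` attached at height `K` -/

/-- Index set of the escape tree `Y_K`: pairs `(s, n)` with `n < K` or `s = false` — the «line»
`(false, n), n ∈ ℕ` (a ray) and the «arm» `(true, n), n < K`. [cite: MochizukiSemiAnbd2006, Thm 3.7(iii) p.41] -/
def EscIdx (K : ℕ) : Type := {p : Bool × ℕ // p.2 < K ∨ p.1 = false}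

/-- The canonical representative of `(s, n)` in `Y_K`: the arm point if `n < K`, else the line point.
[cite: MochizukiSemiAnbd2006, Thm 3.7(iii) p.41] -/
def escRep (K : ℕ) (s : Bool) (n : ℕ) : EscIdx K :=
  ⟨(s && decide (n < K), n), by by_cases h : n < K <;> simp [h]⟩

/-- The underlying pair of a representative. [cite: MochizukiSemiAnbd2006, Thm 3.7(iii) p.41] -/
@[simp] theorem escRep_val (K : ℕ) (s : Bool) (n : ℕ) :
    (escRep K s n).1 = (s && decide (n < K), n) := rfl

/-- Points of `Y_K` with the same underlying pair are equal. [cite: MochizukiSemiAnbd2006, Thm 3.7(iii) p.41] -/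
theorem EscIdx.ext {K : ℕ} {p q : EscIdx K} (h : p.1 = q.1) : p = q := Subtype.ext h

/-- On a point of `Y_K` the representative map is the identity. [cite: MochizukiSemiAnbd2006, Thm 3.7(iii) p.41] -/
theorem escRep_self {K : ℕ} (p : EscIdx K) : escRep K p.1.1 p.1.2 = p := by
  apply EscIdx.ext
  obtain ⟨⟨s, n⟩, hp⟩ := p
  rcases hp with h | h
  · simp [h]
  · simp only at h
    simp [h]

/-- **The escape tree `Y_K`**: vertices and edges both indexed by `EscIdx K`; the edge `(s, n)` joins the
vertex `(s, n)` to the representative of `(s, n+1)` (so the arm edge `(true, K-1)` ends at the line vertex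
`(false, K)`); every edge is closed, with branches `(e, false)` (lower end) and `(e, true)` (upper end).
[cite: MochizukiSemiAnbd2006, Thm 3.7(iii) p.41] -/
def escapeTree (K : ℕ) : SemiGraph.{0} where
  Vertex := EscIdx K
  Edge := EscIdx K
  Branch := EscIdx K × Bool
  edgeOf b := b.1
  abuts b := some (if b.2 then escRep K b.1.1.1 (b.1.1.2 + 1) else b.1)
  two_branches e := ⟨(e, false), (e, true), by simp, rfl, rfl, fun b hb => by
    obtain ⟨e', c⟩ := b
    change e' = e at hb
    subst hb
    cases c
    · exact Or.inl rfl
    · exact Or.inr rfl⟩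

/-- The edge of a branch of `Y_K`. [cite: MochizukiSemiAnbd2006, Thm 3.7(iii) p.41] -/
@[simp] theorem escapeTree_edgeOf (K : ℕ) (b : EscIdx K × Bool) : (escapeTree K).edgeOf b = b.1 := rfl

/-- The lower branch of the edge `e` abuts to the vertex `e`. [cite: MochizukiSemiAnbd2006, Thm 3.7(iii) p.41] -/
@[simp] theorem escapeTree_abuts_false (K : ℕ) (e : EscIdx K) :
    (escapeTree K).abuts (e, false) = some e := rfl

/-- The upper branch of the edge `(s, n)` abuts to the representative of `(s, n+1)`.
[cite: MochizukiSemiAnbd2006, Thm 3.7(iii) p.41] -/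
@[simp] theorem escapeTree_abuts_true (K : ℕ) (e : EscIdx K) :
    (escapeTree K).abuts (e, true) = some (escRep K e.1.1 (e.1.2 + 1)) := rfl

/-- `Y_K` is a graph: every branch abuts to a vertex. [cite: MochizukiSemiAnbd2006, Thm 3.7(iii) p.41] -/
theorem escapeTree_isGraph (K : ℕ) : (escapeTree K).IsGraph := ⟨fun _ => rfl⟩


/-! ### `Y_K` is a tree: rank and parent from the root `(false, 0)` -/

/-- The root of `Y_K`: the line vertex `(false, 0)`. [cite: MochizukiSemiAnbd2006, §1 p.13] -/
def escRoot (K : ℕ) : (escapeTree K).Node := Sum.inl ⟨(false, 0), Or.inr rfl⟩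

/-- Rank of a node of the subdivision of `Y_K`: its distance from the root `(false, 0)` (up the line;
through the junction `(false, K)` and down the arm). [cite: MochizukiSemiAnbd2006, §1 p.13] -/
def escRank (K : ℕ) : (escapeTree K).Node → ℕ
  | Sum.inl p => if p.1.1 then 8 * K - 4 * p.1.2 else 4 * p.1.2
  | Sum.inr (Sum.inl p) => if p.1.1 then 8 * K - (4 * p.1.2 + 2) else 4 * p.1.2 + 2
  | Sum.inr (Sum.inr b) =>
      if b.2 then (if b.1.1.1 then 8 * K - (4 * b.1.1.2 + 3) else 4 * b.1.1.2 + 3)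
      else (if b.1.1.1 then 8 * K - (4 * b.1.1.2 + 1) else 4 * b.1.1.2 + 1)

/-- Parent of a node of the subdivision of `Y_K` (its neighbour towards the root; the root is sent to
itself). [cite: MochizukiSemiAnbd2006, §1 p.13] -/
def escPar (K : ℕ) : (escapeTree K).Node → (escapeTree K).Node
  | Sum.inl p =>
      if p.1.1 then Sum.inr (Sum.inr (p, false))
      else (if p.1.2 = 0 then Sum.inl p
        else Sum.inr (Sum.inr ((⟨(false, p.1.2 - 1), Or.inr rfl⟩ : EscIdx K), true)))
  | Sum.inr (Sum.inl p) => if p.1.1 then Sum.inr (Sum.inr (p, true)) else Sum.inr (Sum.inr (p, false))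
  | Sum.inr (Sum.inr b) =>
      if b.2 then (if b.1.1.1 then Sum.inl (escRep K true (b.1.1.2 + 1)) else Sum.inr (Sum.inl b.1))
      else (if b.1.1.1 then Sum.inr (Sum.inl b.1) else Sum.inl b.1)

/-- The rank strictly decreases along the parent map. [cite: MochizukiSemiAnbd2006, §1 p.13] -/
theorem escRank_escPar_lt (K : ℕ) (x : (escapeTree K).Node) (hx : x ≠ escRoot K) :
    escRank K (escPar K x) < escRank K x := by
  rcases x with ⟨⟨s, m⟩, hp⟩ | ⟨⟨s, n⟩, hp⟩ | ⟨⟨⟨s, n⟩, hp⟩, c⟩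
  · -- vertex
    cases s
    · by_cases hm : m = 0
      · exfalso; apply hx; subst hm; rfl
      · simp [escPar, escRank, hm]
        omega
    · have hmK : m < K := by
        rcases hp with hp | hp
        · exact hp
        · simp at hp
      simp [escPar, escRank]
      omega
  · -- edge
    cases s
    · simp [escPar, escRank]
    · have hnK : n < K := by
        rcases hp with hp | hp
        · exact hp
        · simp at hp
      simp [escPar, escRank]
      omega
  · -- branch
    cases s <;> cases c
    · simp [escPar, escRank]
    · simp [escPar, escRank]
    · have hnK : n < K := by
        rcases hp with hp | hp
        · exact hp
        · simp at hp
      simp [escPar, escRank]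
      omega
    · have hnK : n < K := by
        rcases hp with hp | hp
        · exact hp
        · simp at hp
      by_cases h1 : n + 1 < K
      · simp [escPar, escRank, h1]
        omega
      · simp [escPar, escRank, h1]
        omega

/-- Every non-root node is adjacent to its parent. [cite: MochizukiSemiAnbd2006, §1 p.13] -/
theorem escPar_adj (K : ℕ) (x : (escapeTree K).Node) (hx : x ≠ escRoot K) :
    (escapeTree K).subdivision.Adj x (escPar K x) := by
  rw [subdivision_adj_iff]
  rcases x with ⟨⟨s, m⟩, hp⟩ | ⟨⟨s, n⟩, hp⟩ | ⟨⟨⟨s, n⟩, hp⟩, c⟩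
  · -- vertex: its parent is a branch abutting to it
    cases s
    · by_cases hm : m = 0
      · exfalso; apply hx; subst hm; rfl
      · simp only [escPar, hm, if_false, Bool.false_eq_true]
        refine Or.inr (NodeRel.branch_vertex _ _ ?_)
        refine congrArg some (EscIdx.ext ?_)
        simp
        omega
    · exact Or.inr (NodeRel.branch_vertex (G := escapeTree K) (⟨(true, m), hp⟩, false) _ rfl)
  · -- edge: its parent is one of its branches
    cases s
    · exact Or.inl (NodeRel.edge_branch (G := escapeTree K) (⟨(false, n), hp⟩, false))
    · exact Or.inl (NodeRel.edge_branch (G := escapeTree K) (⟨(true, n), hp⟩, true))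
  · -- branch
    cases s <;> cases c
    · exact Or.inl (NodeRel.branch_vertex (G := escapeTree K) (⟨(false, n), hp⟩, false) _ rfl)
    · exact Or.inr (NodeRel.edge_branch (G := escapeTree K) (⟨(false, n), hp⟩, true))
    · exact Or.inr (NodeRel.edge_branch (G := escapeTree K) (⟨(true, n), hp⟩, false))
    · exact Or.inl (NodeRel.branch_vertex (G := escapeTree K) (⟨(true, n), hp⟩, true) _ rfl)

/-- Every incidence of `Y_K` is a parent step. [cite: MochizukiSemiAnbd2006, §1 p.13] -/
theorem escPar_of_nodeRel (K : ℕ) {x y : (escapeTree K).Node} (h : (escapeTree K).NodeRel x y) :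
    (x ≠ escRoot K ∧ y = escPar K x) ∨ (y ≠ escRoot K ∧ x = escPar K y) := by
  rcases h with ⟨b⟩ | ⟨b, v, hv⟩
  · -- edge – branch
    obtain ⟨⟨⟨s, n⟩, hp⟩, c⟩ := b
    cases s <;> cases c
    · exact Or.inl ⟨by simp [escRoot], rfl⟩
    · exact Or.inr ⟨by simp [escRoot], rfl⟩
    · exact Or.inr ⟨by simp [escRoot], rfl⟩
    · exact Or.inl ⟨by simp [escRoot], rfl⟩
  · -- branch – vertex
    obtain ⟨⟨⟨s, n⟩, hp⟩, c⟩ := b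
    cases s <;> cases c
    · have hv' : (⟨(false, n), hp⟩ : EscIdx K) = v := Option.some.inj hv
      subst hv'
      exact Or.inl ⟨by simp [escRoot], rfl⟩
    · have hv' : escRep K false (n + 1) = v := Option.some.inj hv
      subst hv'
      refine Or.inr ⟨?_, ?_⟩
      · intro h
        have h' := congrArg (fun r : EscIdx K => r.1.2) (Sum.inl.inj h)
        simp at h'
      · simp [escPar]
    · have hv' : (⟨(true, n), hp⟩ : EscIdx K) = v := Option.some.inj hv
      subst hv'
      refine Or.inr ⟨?_, rfl⟩
      intro h
      have h' := congrArg (fun r : EscIdx K => r.1.1) (Sum.inl.inj h)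
      simp at h'
    · have hv' : escRep K true (n + 1) = v := Option.some.inj hv
      subst hv'
      exact Or.inl ⟨by simp [escRoot], rfl⟩

/-- **`Y_K` is a tree.** [cite: MochizukiSemiAnbd2006, §1 p.13] -/
theorem escapeTree_isTree (K : ℕ) : (escapeTree K).IsTree := by
  refine ⟨SimpleGraph.isTree_of_parent (escRoot K) (escPar K) (escRank K) (escRank_escPar_lt K)
    (escPar_adj K) ?_⟩
  intro x y hxy
  rw [subdivision_adj_iff] at hxy
  rcases hxy with h | h
  · exact escPar_of_nodeRel K h
  · rcases escPar_of_nodeRel K h with h' | h'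
    · exact Or.inr h'
    · exact Or.inl h'


end SemiGraph

end Literature.AnabelianGeometry.SemiGraphs
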